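import Literature.MathematicalPhysics.PowerSystems.OscillatorNetworkTypeCounts
import HarnessLib

/-!
# The effective-resistance stability criterion for a ring with ONE line loaded beyond `π/2`
# (Zelazo–Bürger 2014 / Chen–Wang–Liu–Başar–Johansson–Qiu 2016, cycle case): stable iff
# `a · Σₖ 1/bₖ ≤ 1`, strictly stable iff `< 1`, a TYPE-1 saddle iff `> 1` — first-order and swing

Topic `Literature/MathematicalPhysics/PowerSystems`; namespaces `…PowerSystems.SignedCycle` (§1–§2,
linear algebra of the signed cycle Laplacian), `…NonuniformKuramoto` (§3), `…ClassicalModel.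
LosslessSystem` (§4). Everything is PROVED: 0 definitions, 0 named facts, 0 `sorry`. The TYPE
statements reuse `RefNode.refMinor_counts` (`OscillatorNetworkTypeCounts.lean`) and the tree's
`countP_roots_charpoly_toDroopNetwork_auxJac` / `countP_roots_charpoly_phaseJac_modRotation`.

SOURCE (held, read on the page this session: `lit read paper:doi-10-1016-j-ifacol-2016-10-379`,
chunks p0002, p0005–p0008). W. Chen, D. Wang, J. Liu, T. Başar, K. H. Johansson, L. Qiu, *On
semidefiniteness of signed Laplacians with application to microgrids*, IFAC-PapersOnLine 49-22
(2016) 97–102 [ChenWangLiuBasarJohanssonQiu2016]. §1 (p0002 L11): «Zelazo and Bürger (2014),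
signed Laplacians with only one negative weight … such a signed Laplacian is positive semidefinite
if, and only if, the effective resistance over the negatively weighted edge is nonnegative.»
§4 **Corollary 2** (p0007 L1–L3): «If G does not have any cycle containing two negatively weighted
edges, then L is positive semidefinite and of corank(L) = 1 if, and only if, G is connected, and
r⁺_eff(i, j) < 1/|a_ij| for all (i, j) ∈ E₋, where r⁺_eff(i, j) = u_ijᵀ L⁺† u_ij … is the effective
resistance between nodes i and j over the subgraph G₊.» §5 (p0008; inverter-based microgrid = droop
/ first-order model with damping `K > 0`, `J(θ₀) = −K⁻¹ D W(θ₀) Dᵀ`): «there may well exist some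
critical lines across which the angle differences are greater than π/2 … by Sylvester's law of
inertia, one can verify that J(θ₀) has exactly the same number of positive, negative, and zero
eigenvalues as −L(θ₀) … the equilibrium point θ₀ is small-disturbance stable if, and only if,
L(θ₀) is positive semidefinite and has a simple zero eigenvalue.» Also D. Zelazo, M. Bürger, Proc.
53rd IEEE CDC (2014) 2895–2900, Thm III.3 (cited through the above; not held).

THE CYCLE CASE, typed here with an elementary proof. On a ring the positive subgraph left by ONE
negative line `(m, 0)` is the path `0 – 1 – ⋯ – m`, whose effective resistance between the
end-nodes is the series resistance `R = Σₖ 1/bₖ`; the printed condition `r⁺_eff < 1/|a|` reads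
`a·R < 1`. Proofs: Cauchy–Schwarz `(x_m − x_0)² = (Σ dₖ)² ≤ R · Σ bₖdₖ²` for sufficiency, the
unit-current potential `xᵢ = Σ_{k<i} 1/bₖ` (`Q(x) = R(1 − aR)`) for necessity / the marginal kernel,
and the kernel-form Courant–Fischer counts of this topic for the inertia `(n₋, n₀, n₊) = (1, 1, m−1)`
beyond the threshold.

RENDERING. Nodes `Fin (m+1)`, `m ≥ 2`; ring lines `(i, ρ i)` with `ρ = finRotate (m+1)`, i.e. the
path lines `(castSucc k, succ k)`, `k : Fin m`, and the closing line `(last m, 0)`; the coupling is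
symmetric and SUPPORTED ON THE RING (`P i j ≠ 0 ⇒ j = ρ i ∨ i = ρ j`). At a configuration `θ`:
`bₖ := P_{k,k+1} cos(θ_k − θ_{k+1})` (assumed `> 0`: short lines) and the closing-line weight
`w₀ := P_{m,0} cos(θ_m − θ_0)`, `a := −w₀` (the interesting case is `a > 0`, a line loaded beyond
`π/2`; the statements hold for any sign). Any ring with one long line is so labelled.

WHAT IS PROVED.
* §1 (`SignedCycle`, pure linear algebra) `form_nonneg_of_mul_resistance_le_one` (`aR ≤ 1 ⇒ Q ≥ 0`),
  `const_of_form_eq_zero_of_mul_resistance_lt_one` (`aR < 1 ⇒ ker Q = ℝ𝟙`),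
  `exists_form_neg_of_one_lt_mul_resistance` (`aR > 1 ⇒ Q(x) < 0` at the unit-current potential),
  `exists_nonconst_form_eq_zero_of_mul_resistance_eq_one` (`aR = 1`: non-constant kernel vector),
  ★★ **`inertia_of_one_lt_mul_resistance`** (`aR > 1 ⇒ (n₋, n₀, n₊)(H) = (1, 1, m − 1)` for any
  symmetric `H` with form `Q`).
* §2 `sum_sum_eq_two_mul_sum_edges`, `ring_linForm_eq`: on a ring-supported symmetric coupling the
  linearised form `Σᵢxᵢ Σⱼ Pᵢⱼcos(θᵢ − θⱼ)(xᵢ − xⱼ)` IS the signed cycle form `Σₖ bₖ(x_{k+1} − x_k)²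
  − a(x_0 − x_m)²`.
* §3 FIRST-ORDER RING (`Kur : NonuniformKuramoto (m+1)`, lossless, ANY `ω`, ANY `Dᵢ > 0`):
  ★★★ **`ringLongLine_stabilityMatrix_negSemidef_iff`** (`−L(θ)` NSD ⟺ `aR ≤ 1`),
  ★★ **`ringLongLine_stabilityMatrix_negDef_iff`** (negative definite off the rotation ⟺ `aR < 1`),
  ★★ `ringLongLine_criterion_of_lockedSolution_stable` (Lyapunov-stable locked solution ⇒ `aR ≤ 1`),
  ★★ `ringLongLine_lockedSolution_locally_expStable_of_lt_one` / `…_stable_of_lt_one` (`aR < 1` ⇒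
  locally exponentially stable modulo rotation ⇒ Lyapunov-stable: a STABLE operating point with a
  line beyond `π/2`), ★★★ **`ringLongLine_typeOne_auxJac_of_one_lt`** (`aR > 1` ⇒ the Jacobian
  `−D⁻¹L(θ)` has exactly ONE root in the open right half-plane, `m − 1` in the left, one on the
  axis: a type-1 saddle, hyperbolic modulo rotation).
* §4 SWING RING (`S : ClassicalModel.LosslessSystem (m+1) 0`, `Mᵢ, Dᵢ > 0`, any injections):
  ★★ `ringLongLine_criterion_of_stable_syncSolution` (stable ⇒ `aR ≤ 1`),
  ★★ `ringLongLine_stable_syncSolution_of_lt_one` (`aR < 1` ⇒ Lyapunov-stable and attracting),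
  ★★★ `ringLongLine_typeOne_phaseJac_of_one_lt` (`aR > 1` ⇒ exactly one RHP root of the swing
  Jacobian, `(m − 1) + (m + 1)` LHP roots, one on the axis).

THREE COLUMNS. CERTIFIED: kernel theorems — for a ring operating point with one line beyond `π/2`
the exact stability boundary is the series-resistance identity `a·Σ 1/bₖ = 1`, below it stable (both
tiers, Lyapunov), above it a type-1 saddle. MODELLED: lossless ring (single cycle), constant
voltages, first-order oscillators / droop inverters and classical swing machines. NOT CLAIMED:
meshed networks with several cycles or several long lines (the printed Theorems 1–3 with resistance
MATRICES), the marginal case `a·Σ 1/bₖ = 1` dynamically, lossy lines.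
-/

noncomputable section

open Real Set Filter Topology Metric Finset Matrix
open scoped Matrix
open Literature.LinearAlgebra.Matrix (refMinor refMinor_isHermitian)

namespace Literature.MathematicalPhysics.PowerSystems

namespace SignedCycle

/-! ### §1. The signed Laplacian form of a cycle with ONE negative edge: positive semi-definite iff
the effective-resistance inequality `a · Σ 1/bₖ ≤ 1`; kernel = constants iff `< 1`; one negative
eigenvalue iff `> 1` (Zelazo–Bürger / Chen et al., cycle case, elementary proof) -/

variable {m : ℕ}

/-- Telescoping along the path `0 → 1 → ⋯ → m`. [folklore] -/
private theorem sum_succ_sub_castSucc (x : Fin (m + 1) → ℝ) :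
    ∑ k : Fin m, (x k.succ - x k.castSucc) = x (Fin.last m) - x 0 := by
  rw [Finset.sum_sub_distrib]
  have h1 := Fin.sum_univ_succ x
  have h2 := Fin.sum_univ_castSucc x
  linarith

/-- **PSD half of the effective-resistance criterion (cycle, one negative edge)**: path edges
`(k, k+1)` with conductances `bₖ > 0`, closing edge `(m, 0)` of weight `−a`; if `a · Σₖ 1/bₖ ≤ 1`
(the negative conductance is dominated by the effective conductance `1/Σ 1/bₖ` of the positive path
between its end-nodes) then the signed Laplacian form `Σₖ bₖ(x_{k+1} − x_k)² − a(x_0 − x_m)²` is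
non-negative. [cite: ChenWangLiuBasarJohanssonQiu2016, §4 Corollary 2 («L is positive semidefinite and of corank 1 iff … r⁺_eff(i,j) < 1/|a_ij|») with §1 (Zelazo and Bürger 2014, Thm III.3: one negative weight, PSD iff the effective resistance over it is nonnegative) (doi:10.1016/j.ifacol.2016.10.379 p0006 L27–p0007 L3)] -/
theorem form_nonneg_of_mul_resistance_le_one {b : Fin m → ℝ} (hb : ∀ k, 0 < b k) {a : ℝ}
    (h : a * ∑ k, 1 / b k ≤ 1) (x : Fin (m + 1) → ℝ) :
    0 ≤ ∑ k : Fin m, b k * (x k.succ - x k.castSucc) ^ 2 - a * (x 0 - x (Fin.last m)) ^ 2 := by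
  have hR0 : 0 ≤ ∑ k, 1 / b k := Finset.sum_nonneg fun k _ => (one_div_pos.2 (hb k)).le
  have hE0 : 0 ≤ ∑ k : Fin m, b k * (x k.succ - x k.castSucc) ^ 2 :=
    Finset.sum_nonneg fun k _ => mul_nonneg (hb k).le (sq_nonneg _)
  -- Cauchy–Schwarz: `(x_m − x_0)² = (Σ dₖ)² ≤ (Σ 1/bₖ)(Σ bₖ dₖ²)`
  have hCS : (x 0 - x (Fin.last m)) ^ 2
      ≤ (∑ k, 1 / b k) * ∑ k : Fin m, b k * (x k.succ - x k.castSucc) ^ 2 := by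
    have h1 := Finset.sum_mul_sq_le_sq_mul_sq (s := (Finset.univ : Finset (Fin m)))
      (fun k => 1 / Real.sqrt (b k)) (fun k => Real.sqrt (b k) * (x k.succ - x k.castSucc))
    have e1 : ∑ k : Fin m, 1 / Real.sqrt (b k) * (Real.sqrt (b k) * (x k.succ - x k.castSucc))
        = x (Fin.last m) - x 0 := by
      rw [← sum_succ_sub_castSucc x]
      refine Finset.sum_congr rfl fun k _ => ?_
      have : Real.sqrt (b k) ≠ 0 := (Real.sqrt_pos.2 (hb k)).ne'
      field_simp
    have e2 : ∑ k : Fin m, (1 / Real.sqrt (b k)) ^ 2 = ∑ k, 1 / b k := by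
      refine Finset.sum_congr rfl fun k _ => ?_
      rw [div_pow, one_pow, Real.sq_sqrt (hb k).le]
    have e3 : ∑ k : Fin m, (Real.sqrt (b k) * (x k.succ - x k.castSucc)) ^ 2
        = ∑ k : Fin m, b k * (x k.succ - x k.castSucc) ^ 2 := by
      refine Finset.sum_congr rfl fun k _ => ?_
      rw [mul_pow, Real.sq_sqrt (hb k).le]
    rw [e1, e2, e3] at h1
    calc (x 0 - x (Fin.last m)) ^ 2 = (x (Fin.last m) - x 0) ^ 2 := by ring
      _ ≤ _ := h1
  by_cases ha : 0 ≤ a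
  · have h2 : a * (x 0 - x (Fin.last m)) ^ 2
        ≤ a * ((∑ k, 1 / b k) * ∑ k : Fin m, b k * (x k.succ - x k.castSucc) ^ 2) :=
      mul_le_mul_of_nonneg_left hCS ha
    have h3 : a * ((∑ k, 1 / b k) * ∑ k : Fin m, b k * (x k.succ - x k.castSucc) ^ 2)
        ≤ 1 * ∑ k : Fin m, b k * (x k.succ - x k.castSucc) ^ 2 := by
      rw [← mul_assoc]
      exact mul_le_mul_of_nonneg_right h hE0
    linarith
  · have : a * (x 0 - x (Fin.last m)) ^ 2 ≤ 0 :=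
      mul_nonpos_of_nonpos_of_nonneg (not_le.1 ha).le (sq_nonneg _)
    linarith

/-- **Strict version: kernel = constants.** If `a · Σₖ 1/bₖ < 1` then the form vanishes only on
constant vectors. [cite: ChenWangLiuBasarJohanssonQiu2016, §4 Corollary 2 («corank(L) = 1»)] -/
theorem const_of_form_eq_zero_of_mul_resistance_lt_one {b : Fin m → ℝ} (hb : ∀ k, 0 < b k) {a : ℝ}
    (h : a * ∑ k, 1 / b k < 1) {x : Fin (m + 1) → ℝ}
    (hx : ∑ k : Fin m, b k * (x k.succ - x k.castSucc) ^ 2 - a * (x 0 - x (Fin.last m)) ^ 2 = 0) :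
    ∀ i, x i = x 0 := by
  have hR0 : 0 ≤ ∑ k, 1 / b k := Finset.sum_nonneg fun k _ => (one_div_pos.2 (hb k)).le
  set E := ∑ k : Fin m, b k * (x k.succ - x k.castSucc) ^ 2 with hE
  have hE0 : 0 ≤ E := Finset.sum_nonneg fun k _ => mul_nonneg (hb k).le (sq_nonneg _)
  have hCS : (x 0 - x (Fin.last m)) ^ 2 ≤ (∑ k, 1 / b k) * E := by
    have h1 := Finset.sum_mul_sq_le_sq_mul_sq (s := (Finset.univ : Finset (Fin m)))
      (fun k => 1 / Real.sqrt (b k)) (fun k => Real.sqrt (b k) * (x k.succ - x k.castSucc))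
    have e1 : ∑ k : Fin m, 1 / Real.sqrt (b k) * (Real.sqrt (b k) * (x k.succ - x k.castSucc))
        = x (Fin.last m) - x 0 := by
      rw [← sum_succ_sub_castSucc x]
      refine Finset.sum_congr rfl fun k _ => ?_
      have : Real.sqrt (b k) ≠ 0 := (Real.sqrt_pos.2 (hb k)).ne'
      field_simp
    have e2 : ∑ k : Fin m, (1 / Real.sqrt (b k)) ^ 2 = ∑ k, 1 / b k := by
      refine Finset.sum_congr rfl fun k _ => ?_
      rw [div_pow, one_pow, Real.sq_sqrt (hb k).le]
    have e3 : ∑ k : Fin m, (Real.sqrt (b k) * (x k.succ - x k.castSucc)) ^ 2 = E := by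
      refine Finset.sum_congr rfl fun k _ => ?_
      rw [mul_pow, Real.sq_sqrt (hb k).le]
    rw [e1, e2, e3] at h1
    calc (x 0 - x (Fin.last m)) ^ 2 = (x (Fin.last m) - x 0) ^ 2 := by ring
      _ ≤ _ := h1
  -- `E = a D² ≤ a R E` forces `E = 0`
  have hEz : E = 0 := by
    by_contra hne
    have hEpos : 0 < E := lt_of_le_of_ne hE0 (Ne.symm hne)
    by_cases ha : 0 ≤ a
    · have h2 : a * (x 0 - x (Fin.last m)) ^ 2 ≤ a * ((∑ k, 1 / b k) * E) :=
        mul_le_mul_of_nonneg_left hCS ha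
      have h3 : a * ((∑ k, 1 / b k) * E) < 1 * E := by
        rw [← mul_assoc]
        exact mul_lt_mul_of_pos_right h hEpos
      linarith
    · have : a * (x 0 - x (Fin.last m)) ^ 2 ≤ 0 :=
        mul_nonpos_of_nonpos_of_nonneg (not_le.1 ha).le (sq_nonneg _)
      linarith
  have hd : ∀ k : Fin m, x k.succ = x k.castSucc := by
    intro k
    have hk := (Finset.sum_eq_zero_iff_of_nonneg fun k _ => mul_nonneg (hb k).le (sq_nonneg _)).1
      hEz k (Finset.mem_univ k)
    rcases mul_eq_zero.1 hk with h0 | h0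
    · exact absurd h0 (hb k).ne'
    · have := pow_eq_zero_iff two_ne_zero |>.1 h0
      linarith
  -- walk up the path
  intro i
  induction i using Fin.induction with
  | zero => rfl
  | succ k ih => rw [hd k, ih]

/-- **The negative half, with an explicit witness**: if `a · Σₖ 1/bₖ > 1` then the unit-current
potential `xᵢ = Σ_{k<i} 1/bₖ` makes the form negative: `Q(x) = R(1 − aR) < 0`, `R = Σ 1/bₖ`.
[cite: ChenWangLiuBasarJohanssonQiu2016, §3 (unit current injected into node i and extracted from node j; effective resistance) and §4 Corollary 2] -/
theorem exists_form_neg_of_one_lt_mul_resistance {b : Fin m → ℝ} (hb : ∀ k, 0 < b k) {a : ℝ}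
    (h : 1 < a * ∑ k, 1 / b k) :
    ∃ x : Fin (m + 1) → ℝ,
      ∑ k : Fin m, b k * (x k.succ - x k.castSucc) ^ 2 - a * (x 0 - x (Fin.last m)) ^ 2 < 0 := by
  classical
  set c : ℕ → ℝ := fun l => if hl : l < m then 1 / b ⟨l, hl⟩ else 0 with hc
  refine ⟨fun i => ∑ l ∈ Finset.range i.val, c l, ?_⟩
  have hd : ∀ k : Fin m, (∑ l ∈ Finset.range (k.succ : Fin (m + 1)).val, c l)
      - (∑ l ∈ Finset.range (k.castSucc : Fin (m + 1)).val, c l) = 1 / b k := by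
    intro k
    rw [Fin.val_succ, Fin.val_castSucc, Finset.sum_range_succ, add_sub_cancel_left]
    simp [hc, k.2]
  have hlast : (∑ l ∈ Finset.range (Fin.last m : Fin (m + 1)).val, c l) = ∑ k : Fin m, 1 / b k := by
    rw [Fin.val_last, ← Fin.sum_univ_eq_sum_range]
    refine Finset.sum_congr rfl fun k _ => ?_
    simp [hc, k.2]
  have h0 : (∑ l ∈ Finset.range (0 : Fin (m + 1)).val, c l) = 0 := by simp
  simp only [hd, hlast, h0, zero_sub]
  have hR : 0 < ∑ k, 1 / b k := by
    rcases Nat.eq_zero_or_pos m with hm | hm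
    · subst hm
      simp at h
      linarith
    · haveI : Nonempty (Fin m) := ⟨⟨0, hm⟩⟩
      exact Finset.sum_pos (fun k _ => one_div_pos.2 (hb k)) Finset.univ_nonempty
  have e : ∑ k : Fin m, b k * (1 / b k) ^ 2 = ∑ k, 1 / b k := by
    refine Finset.sum_congr rfl fun k _ => ?_
    have := (hb k).ne'
    field_simp
  rw [e, neg_sq]
  nlinarith

/-- **The marginal case is not strict**: if `a · Σₖ 1/bₖ = 1` the same non-constant potential lies in
the kernel of the form. [cite: ChenWangLiuBasarJohanssonQiu2016, §4 Corollary 2 (strict inequality for corank 1)] -/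
theorem exists_nonconst_form_eq_zero_of_mul_resistance_eq_one {b : Fin m → ℝ} (hb : ∀ k, 0 < b k)
    {a : ℝ} (hm : 0 < m) (h : a * ∑ k, 1 / b k = 1) :
    ∃ x : Fin (m + 1) → ℝ, x (Fin.last m) ≠ x 0 ∧
      ∑ k : Fin m, b k * (x k.succ - x k.castSucc) ^ 2 - a * (x 0 - x (Fin.last m)) ^ 2 = 0 := by
  classical
  set c : ℕ → ℝ := fun l => if hl : l < m then 1 / b ⟨l, hl⟩ else 0 with hc
  refine ⟨fun i => ∑ l ∈ Finset.range i.val, c l, ?_, ?_⟩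
  · have hlast : (∑ l ∈ Finset.range (Fin.last m : Fin (m + 1)).val, c l) = ∑ k : Fin m, 1 / b k := by
      rw [Fin.val_last, ← Fin.sum_univ_eq_sum_range]
      refine Finset.sum_congr rfl fun k _ => ?_
      simp [hc, k.2]
    have h0 : (∑ l ∈ Finset.range (0 : Fin (m + 1)).val, c l) = 0 := by simp
    simp only [hlast, h0]
    haveI : Nonempty (Fin m) := ⟨⟨0, hm⟩⟩
    exact (Finset.sum_pos (fun k _ => one_div_pos.2 (hb k)) Finset.univ_nonempty).ne'
  · have hd : ∀ k : Fin m, (∑ l ∈ Finset.range (k.succ : Fin (m + 1)).val, c l)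
        - (∑ l ∈ Finset.range (k.castSucc : Fin (m + 1)).val, c l) = 1 / b k := by
      intro k
      rw [Fin.val_succ, Fin.val_castSucc, Finset.sum_range_succ, add_sub_cancel_left]
      simp [hc, k.2]
    have hlast : (∑ l ∈ Finset.range (Fin.last m : Fin (m + 1)).val, c l) = ∑ k : Fin m, 1 / b k := by
      rw [Fin.val_last, ← Fin.sum_univ_eq_sum_range]
      refine Finset.sum_congr rfl fun k _ => ?_
      simp [hc, k.2]
    have h0 : (∑ l ∈ Finset.range (0 : Fin (m + 1)).val, c l) = 0 := by simp
    simp only [hd, hlast, h0, zero_sub]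
    have e : ∑ k : Fin m, b k * (1 / b k) ^ 2 = ∑ k, 1 / b k := by
      refine Finset.sum_congr rfl fun k _ => ?_
      have := (hb k).ne'
      field_simp
    rw [e, neg_sq]
    set R := ∑ k, 1 / b k
    have : R - a * R ^ 2 = R * (1 - a * R) := by ring
    rw [this, h, sub_self, mul_zero]

/-- **Translation-invariant forms annihilate the constants**: if `xᵀHx` depends only on the
differences `x_{k+1} − x_k`, `x_0 − x_m` then `H𝟙 = 0`. [folklore] -/
private theorem mulVec_one_eq_zero {H : Matrix (Fin (m + 1)) (Fin (m + 1)) ℝ} (hH : H.IsHermitian)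
    {b : Fin m → ℝ} {a : ℝ}
    (hform : ∀ x : Fin (m + 1) → ℝ, x ⬝ᵥ H *ᵥ x
      = ∑ k : Fin m, b k * (x k.succ - x k.castSucc) ^ 2 - a * (x 0 - x (Fin.last m)) ^ 2) :
    H *ᵥ (fun _ => (1 : ℝ)) = 0 := by
  have hT : Hᵀ = H := Literature.Analysis.Matrix.KyFan.transpose_eq hH
  have hsymm : ∀ x y : Fin (m + 1) → ℝ, x ⬝ᵥ H *ᵥ y = y ⬝ᵥ H *ᵥ x := by
    intro x y
    rw [dotProduct_mulVec, ← mulVec_transpose, hT, dotProduct_comm]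
  have hpol : ∀ x y : Fin (m + 1) → ℝ,
      (x + y) ⬝ᵥ H *ᵥ (x + y) = x ⬝ᵥ H *ᵥ x + 2 * (x ⬝ᵥ H *ᵥ y) + y ⬝ᵥ H *ᵥ y := by
    intro x y
    rw [mulVec_add, add_dotProduct, dotProduct_add, dotProduct_add, hsymm y x]
    ring
  have hinv : ∀ x : Fin (m + 1) → ℝ, (x + fun _ => (1 : ℝ)) ⬝ᵥ H *ᵥ (x + fun _ => (1 : ℝ))
      = x ⬝ᵥ H *ᵥ x := by
    intro x
    rw [hform, hform]
    simp only [Pi.add_apply, add_sub_add_right_eq_sub]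
  have hone : (fun _ : Fin (m + 1) => (1 : ℝ)) ⬝ᵥ H *ᵥ (fun _ => (1 : ℝ)) = 0 := by
    have := hinv 0
    rw [zero_add, mulVec_zero, dotProduct_zero] at this
    exact this
  -- every `x ⬝ H𝟙 = 0`
  have horth : ∀ x : Fin (m + 1) → ℝ, x ⬝ᵥ H *ᵥ (fun _ => (1 : ℝ)) = 0 := by
    intro x
    have := hpol x (fun _ => 1)
    rw [hinv x, hone] at this
    linarith
  funext i
  have := horth (Pi.single i 1)
  rw [single_one_dotProduct] at this
  exact this

/-- ★★ **INERTIA beyond the threshold: exactly ONE negative eigenvalue and a simple zero.** For a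
real symmetric `H` carrying the one-negative-edge cycle form with `a · Σₖ 1/bₖ > 1`:
`n₋(H) = 1`, `n₀(H) = 1`, `n₊(H) = m − 1` (a type-1 saddle of the potential).
[cite: ChenWangLiuBasarJohanssonQiu2016, §5 («J(θ₀) has exactly the same number of positive, negative, and zero eigenvalues as −L(θ₀)») and §4 Corollary 2; HornJohnson2013, Theorem 4.2.10] -/
theorem inertia_of_one_lt_mul_resistance {H : Matrix (Fin (m + 1)) (Fin (m + 1)) ℝ}
    (hH : H.IsHermitian) {b : Fin m → ℝ} (hb : ∀ k, 0 < b k) {a : ℝ}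
    (hform : ∀ x : Fin (m + 1) → ℝ, x ⬝ᵥ H *ᵥ x
      = ∑ k : Fin m, b k * (x k.succ - x k.castSucc) ^ 2 - a * (x 0 - x (Fin.last m)) ^ 2)
    (h : 1 < a * ∑ k, 1 / b k) :
    (univ.filter fun i => hH.eigenvalues i < 0).card = 1
      ∧ (univ.filter fun i => hH.eigenvalues i = 0).card = 1
      ∧ (univ.filter fun i => 0 < hH.eigenvalues i).card = m - 1 := by
  classical
  -- (1) `n₋ ≤ 1`: on `{x_0 = x_m}` the form is `Σ b d² ≥ 0`
  let L1 : (Fin (m + 1) → ℝ) →ₗ[ℝ] ℝ :=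
    { toFun := fun x => x 0 - x (Fin.last m)
      map_add' := fun x y => by simp only [Pi.add_apply]; ring
      map_smul' := fun r x => by simp only [Pi.smul_apply, smul_eq_mul, RingHom.id_apply]; ring }
  have c1 := NonuniformKuramoto.card_eigenvalues_neg_le_of_nonneg_on_ker hH L1
    (le_of_eq (Module.finrank_self ℝ)) fun x hx => by
      have hx' : x 0 - x (Fin.last m) = 0 := hx
      rw [hform, hx']
      simp only [zero_pow two_ne_zero, mul_zero, sub_zero]
      exact Finset.sum_nonneg fun k _ => mul_nonneg (hb k).le (sq_nonneg _)
  -- (2) `#{λ ≤ 0} ≤ 2`: on `{x_0 = x_m, x_0 = 0}` the form is positive off `0`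
  let L2 : (Fin (m + 1) → ℝ) →ₗ[ℝ] (Fin 2 → ℝ) :=
    { toFun := fun x => ![x 0 - x (Fin.last m), x 0]
      map_add' := fun x y => by
        funext i; fin_cases i
        · simp [Pi.add_apply]; ring
        · simp [Pi.add_apply]
      map_smul' := fun r x => by
        funext i; fin_cases i
        · simp [Pi.smul_apply, smul_eq_mul]; ring
        · simp [Pi.smul_apply, smul_eq_mul] }
  have c2 := NonuniformKuramoto.card_eigenvalues_nonpos_le_of_pos_on_ker hH L2
    (le_of_eq (Module.finrank_fin_fun ℝ)) fun x hx0 hx => by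
      have hxa : x 0 - x (Fin.last m) = 0 := by
        have := congrFun hx 0; simpa [L2] using this
      have hxb : x 0 = 0 := by
        have := congrFun hx 1; simpa [L2] using this
      rw [hform, hxa]
      simp only [zero_pow two_ne_zero, mul_zero, sub_zero]
      have hE0 : 0 ≤ ∑ k : Fin m, b k * (x k.succ - x k.castSucc) ^ 2 :=
        Finset.sum_nonneg fun k _ => mul_nonneg (hb k).le (sq_nonneg _)
      refine hE0.lt_of_ne fun hE => hx0 ?_
      have hd : ∀ k : Fin m, x k.succ = x k.castSucc := by
        intro k
        have hk := (Finset.sum_eq_zero_iff_of_nonneg fun k _ =>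
          mul_nonneg (hb k).le (sq_nonneg _)).1 hE.symm k (Finset.mem_univ k)
        rcases mul_eq_zero.1 hk with h0 | h0
        · exact absurd h0 (hb k).ne'
        · have := pow_eq_zero_iff two_ne_zero |>.1 h0
          linarith
      funext i
      rw [Pi.zero_apply]
      induction i using Fin.induction with
      | zero => exact hxb
      | succ k ih => rw [hd k, ih]
  -- (3) `n₋ ≥ 1`: the witness
  have c3 : 1 ≤ (univ.filter fun i => hH.eigenvalues i < 0).card := by
    by_contra hlt
    have h0 : (univ.filter fun i => hH.eigenvalues i < 0).card = 0 := by omega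
    obtain ⟨x, hx⟩ := exists_form_neg_of_one_lt_mul_resistance hb h
    rw [← hform, Literature.Analysis.Matrix.KyFan.dotProduct_mulVec_eq_sum_eigen hH x] at hx
    refine absurd hx (not_lt.2 (Finset.sum_nonneg fun i _ => mul_nonneg ?_ (sq_nonneg _)))
    by_contra hneg
    have : i ∈ (univ.filter fun i => hH.eigenvalues i < 0) := by simp [not_le.1 hneg]
    rw [Finset.card_eq_zero.1 h0] at this
    simp at this
  -- (4) `n₀ ≥ 1`: `H𝟙 = 0`
  have c4 : 1 ≤ (univ.filter fun i => hH.eigenvalues i = 0).card := by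
    have hdet : H.det = 0 :=
      Matrix.exists_mulVec_eq_zero_iff.1 ⟨fun _ => 1, fun h0 => by simpa using congrFun h0 0,
        mulVec_one_eq_zero hH hform⟩
    have hprod := hH.det_eq_prod_eigenvalues
    rw [hdet] at hprod
    simp only [RCLike.ofReal_real_eq_id, id_eq] at hprod
    obtain ⟨i, _, hi⟩ := Finset.prod_eq_zero_iff.1 hprod.symm
    exact Finset.card_pos.2 ⟨i, by simp [hi]⟩
  -- partitions
  have e1 : (univ.filter fun i => hH.eigenvalues i ≤ 0).card
      = (univ.filter fun i => hH.eigenvalues i < 0).card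
        + (univ.filter fun i => hH.eigenvalues i = 0).card := by
    rw [← Finset.card_union_of_disjoint]
    · congr 1
      ext i
      simp only [Finset.mem_filter, Finset.mem_univ, true_and, Finset.mem_union]
      constructor
      · intro hi
        rcases hi.lt_or_eq with hi | hi
        · exact Or.inl hi
        · exact Or.inr hi
      · rintro (hi | hi)
        · exact hi.le
        · rw [hi]
    · exact Finset.disjoint_filter.2 fun i _ h1 h2 => by rw [h2] at h1; exact lt_irrefl _ h1
  have e2 : (univ.filter fun i => hH.eigenvalues i ≤ 0).card
      + (univ.filter fun i => 0 < hH.eigenvalues i).card = m + 1 := by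
    have hh := Finset.card_filter_add_card_filter_not
      (s := (univ : Finset (Fin (m + 1)))) (fun i => hH.eigenvalues i ≤ 0)
    have e : (univ.filter fun i => ¬ hH.eigenvalues i ≤ 0)
        = (univ.filter fun i => 0 < hH.eigenvalues i) := by
      ext i; simp
    rw [e, Finset.card_univ, Fintype.card_fin] at hh
    exact hh
  refine ⟨by omega, by omega, by omega⟩

end SignedCycle

/-! ### §2. Ring-supported couplings: the linearised form is the signed cycle form -/

namespace SignedCycle

variable {m : ℕ}

/-- On a ring of at least three nodes the two neighbours `ρ k` and `ρ⁻¹ k` differ. [folklore] -/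
private theorem rotate_ne_rotate_symm (hm : 2 ≤ m) (k : Fin (m + 1)) :
    finRotate (m + 1) k ≠ (finRotate (m + 1)).symm k := by
  intro h
  set j := (finRotate (m + 1)).symm k with hj
  have hk : finRotate (m + 1) j = k := by simp [hj]
  have h2 : finRotate (m + 1) (finRotate (m + 1) j) = j := by rw [hk]; exact h
  have hv1 : (finRotate (m + 1) j).val = if j = Fin.last m then 0 else j.val + 1 := coe_finRotate j
  have hv2 : (finRotate (m + 1) (finRotate (m + 1) j)).val
      = if finRotate (m + 1) j = Fin.last m then 0 else (finRotate (m + 1) j).val + 1 :=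
    coe_finRotate _
  have hjlt : j.val < m + 1 := j.isLt
  have hval : (finRotate (m + 1) (finRotate (m + 1) j)).val = j.val := by rw [h2]
  by_cases hl : j = Fin.last m
  · have hjn : j.val = m := by rw [hl, Fin.val_last]
    rw [if_pos hl] at hv1
    have hne : finRotate (m + 1) j ≠ Fin.last m := by
      intro h'
      have h'' := congrArg Fin.val h'
      rw [hv1, Fin.val_last] at h''
      omega
    rw [if_neg hne, hv1] at hv2
    omega
  · rw [if_neg hl] at hv1
    have hjn : j.val ≠ m := fun h' => hl (Fin.ext (by rw [h', Fin.val_last]))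
    by_cases hl2 : finRotate (m + 1) j = Fin.last m
    · have h'' := congrArg Fin.val hl2
      rw [hv1, Fin.val_last] at h''
      rw [if_pos hl2] at hv2
      omega
    · rw [if_neg hl2, hv1] at hv2
      omega

/-- `ρ (castSucc k) = succ k` and `ρ (last) = 0`: the ring edges `(i, ρ i)` are the path edges
`(k, k+1)` and the closing edge `(m, 0)`. [folklore] -/
private theorem finRotate_castSucc (k : Fin m) : finRotate (m + 1) k.castSucc = k.succ := by
  apply Fin.ext
  rw [coe_finRotate_of_ne_last (fun h => by
    have := congrArg Fin.val h; rw [Fin.val_castSucc, Fin.val_last] at this; have := k.2; omega),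
    Fin.val_castSucc, Fin.val_succ]

/-- **A symmetric double sum over a ring-supported symmetric matrix is twice the sum over the
ring edges** `(k, k+1)`, `k < m`, and `(m, 0)` (the cycle's `L = D W Dᵀ` written edge by edge).
[cite: ChenWangLiuBasarJohanssonQiu2016, §2 («L = D W Dᵀ», signed Laplacian as a sum over the edges) and §5 eq. (1)] -/
theorem sum_sum_eq_two_mul_sum_edges (hm : 2 ≤ m) {W : Fin (m + 1) → Fin (m + 1) → ℝ}
    (hW : ∀ i j, W i j = W j i)
    (hsupp : ∀ i j, W i j ≠ 0 → j = finRotate (m + 1) i ∨ i = finRotate (m + 1) j)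
    (f : Fin (m + 1) → Fin (m + 1) → ℝ) (hf : ∀ i j, f i j = f j i) :
    ∑ i, ∑ j, W i j * f i j
      = 2 * (∑ k : Fin m, W k.castSucc k.succ * f k.castSucc k.succ
          + W (Fin.last m) 0 * f (Fin.last m) 0) := by
  classical
  set ρ := finRotate (m + 1) with hρ
  -- each row is supported on the two neighbours
  have hrow : ∀ i, ∑ j, W i j * f i j = W i (ρ i) * f i (ρ i) + W i (ρ.symm i) * f i (ρ.symm i) := by
    intro i
    rw [Fintype.sum_eq_add (ρ i) (ρ.symm i) (rotate_ne_rotate_symm hm i)]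
    intro j ⟨hj1, hj2⟩
    have : W i j = 0 := by
      by_contra hne
      rcases hsupp i j hne with h | h
      · exact hj1 h
      · exact hj2 (by rw [h]; simp [hρ])
    rw [this, zero_mul]
  rw [Finset.sum_congr rfl fun i _ => hrow i, Finset.sum_add_distrib]
  -- the second sum is the first one, re-indexed by `i = ρ j`
  have hre : ∑ i, W i (ρ.symm i) * f i (ρ.symm i) = ∑ j, W j (ρ j) * f j (ρ j) := by
    rw [← Equiv.sum_comp ρ (fun i => W i (ρ.symm i) * f i (ρ.symm i))]
    refine Finset.sum_congr rfl fun j _ => ?_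
    simp only [Equiv.symm_apply_apply]
    rw [hW, hf]
  rw [hre, ← two_mul]
  congr 1
  rw [Fin.sum_univ_castSucc]
  simp only [hρ, finRotate_castSucc, finRotate_last]

/-- **The linearised form of a ring network is the signed cycle form**: with edge weights
`bₖ = P_{k,k+1}cos(θ_k − θ_{k+1})` on the path and `w₀ = P_{m,0}cos(θ_m − θ_0)` on the closing line,
`Σᵢ xᵢ Σⱼ Pᵢⱼcos(θᵢ − θⱼ)(xᵢ − xⱼ) = Σₖ bₖ(x_{k+1} − x_k)² + w₀(x_0 − x_m)²`.
[cite: ChenWangLiuBasarJohanssonQiu2016, §5 eq. (1)–(3) («L(θ₀) = D W(θ₀) Dᵀ» with W(θ₀) the line cosines)] -/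
theorem ring_linForm_eq (hm : 2 ≤ m) {P : Fin (m + 1) → Fin (m + 1) → ℝ} (hP : ∀ i j, P i j = P j i)
    (hsupp : ∀ i j, P i j ≠ 0 → j = finRotate (m + 1) i ∨ i = finRotate (m + 1) j)
    (θ x : Fin (m + 1) → ℝ) :
    ∑ i, x i * ∑ j, P i j * Real.cos (θ i - θ j) * (x i - x j)
      = ∑ k : Fin m, P k.castSucc k.succ * Real.cos (θ k.castSucc - θ k.succ)
            * (x k.succ - x k.castSucc) ^ 2
        - (-(P (Fin.last m) 0 * Real.cos (θ (Fin.last m) - θ 0))) * (x 0 - x (Fin.last m)) ^ 2 := by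
  have hw : ∀ i j, P j i * Real.cos (θ j - θ i) = P i j * Real.cos (θ i - θ j) := by
    intro i j
    rw [hP j i, ← Real.cos_neg, neg_sub]
  -- half-sum-of-squares
  have h1 : ∑ i, x i * ∑ j, P i j * Real.cos (θ i - θ j) * (x i - x j)
      = ∑ i, ∑ j, P i j * Real.cos (θ i - θ j) * (x i * (x i - x j)) := by
    refine Finset.sum_congr rfl fun i _ => ?_
    rw [Finset.mul_sum]
    exact Finset.sum_congr rfl fun j _ => by ring
  have h2 : ∑ i, ∑ j, P i j * Real.cos (θ i - θ j) * (x i * (x i - x j))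
      = ∑ i, ∑ j, P i j * Real.cos (θ i - θ j) * (x j * (x j - x i)) := by
    rw [Finset.sum_comm]
    exact Finset.sum_congr rfl fun i _ => Finset.sum_congr rfl fun j _ => by rw [hw]
  have h3 : ∑ i, ∑ j, P i j * Real.cos (θ i - θ j) * (x i - x j) ^ 2
      = ∑ i, ∑ j, P i j * Real.cos (θ i - θ j) * (x i * (x i - x j))
        + ∑ i, ∑ j, P i j * Real.cos (θ i - θ j) * (x j * (x j - x i)) := by
    rw [← Finset.sum_add_distrib]
    refine Finset.sum_congr rfl fun i _ => ?_
    rw [← Finset.sum_add_distrib]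
    exact Finset.sum_congr rfl fun j _ => by ring
  have h4 : ∑ i, x i * ∑ j, P i j * Real.cos (θ i - θ j) * (x i - x j)
      = 1 / 2 * ∑ i, ∑ j, P i j * Real.cos (θ i - θ j) * (x i - x j) ^ 2 := by
    rw [h1, h3, ← h2]; ring
  rw [h4, sum_sum_eq_two_mul_sum_edges hm (W := fun i j => P i j * Real.cos (θ i - θ j))
    (fun i j => (hw i j).symm) (fun i j hne => hsupp i j (left_ne_zero_of_mul hne))
    (fun i j => (x i - x j) ^ 2) (fun i j => by ring)]
  have e : ∀ k : Fin m, (x k.castSucc - x k.succ) ^ 2 = (x k.succ - x k.castSucc) ^ 2 :=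
    fun k => by ring
  have e0 : (x (Fin.last m) - x 0) ^ 2 = (x 0 - x (Fin.last m)) ^ 2 := by ring
  simp only [e, e0]
  ring

end SignedCycle

/-! ### §3. THE MODEL: first-order Kuramoto / droop ring with ONE long line -/

namespace NonuniformKuramoto

variable {m : ℕ} (Kur : NonuniformKuramoto (m + 1))

/-- ★★★ **EFFECTIVE-RESISTANCE STABILITY CRITERION FOR A RING WITH ONE LONG LINE, print's notion
(stability matrix negative semi-definite).** MODEL: first-order Kuramoto oscillators / droop
inverters on a ring of `m + 1 ≥ 3` nodes (symmetric coupling supported on the ring lines, ANY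
natural frequencies, ANY `Dᵢ > 0`); a configuration `θ` at which the path lines `(k, k+1)` are
short (`bₖ := P_{k,k+1}cos(θ_k − θ_{k+1}) > 0`) and the closing line `(m, 0)` is LONG
(`a := −P_{m,0}cos(θ_m − θ_0) > 0`). Then `−L(θ)` is negative semi-definite IFF
`a · Σₖ 1/bₖ ≤ 1` — the negative conductance of the long line is at most the effective conductance of
the rest of the ring between its end-nodes. [cite: ChenWangLiuBasarJohanssonQiu2016, §4 Corollary 2 and §5 («the equilibrium point θ₀ is small-disturbance stable if, and only if, L(θ₀) is positive semidefinite and has a simple zero eigenvalue») (doi:10.1016/j.ifacol.2016.10.379 p0006–p0008); §1 ibid. (Zelazo–Bürger 2014, Thm III.3)] -/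
theorem ringLongLine_stabilityMatrix_negSemidef_iff (hm : 2 ≤ m) (hP : ∀ i j, Kur.P i j = Kur.P j i)
    (hsupp : ∀ i j, Kur.P i j ≠ 0 → j = finRotate (m + 1) i ∨ i = finRotate (m + 1) j)
    (θ : Fin (m + 1) → ℝ)
    (hshort : ∀ k : Fin m, 0 < Kur.P k.castSucc k.succ * Real.cos (θ k.castSucc - θ k.succ)) :
    (∀ z : Fin (m + 1) → ℝ, z ⬝ᵥ ((-Kur.toDroopNetwork.lap θ) *ᵥ z) ≤ 0)
      ↔ -(Kur.P (Fin.last m) 0 * Real.cos (θ (Fin.last m) - θ 0))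
          * ∑ k : Fin m, 1 / (Kur.P k.castSucc k.succ * Real.cos (θ k.castSucc - θ k.succ)) ≤ 1 := by
  rw [Kur.stabilityMatrix_negSemidef_iff_linForm_nonneg]
  simp only [SignedCycle.ring_linForm_eq hm hP hsupp θ]
  constructor
  · intro h
    by_contra hlt
    obtain ⟨x, hx⟩ := SignedCycle.exists_form_neg_of_one_lt_mul_resistance hshort (not_le.1 hlt)
    exact absurd (h x) (not_le.2 hx)
  · intro h x
    exact SignedCycle.form_nonneg_of_mul_resistance_le_one hshort h x

/-- ★★ **Strict version: negative definite off the rotation IFF `a · Σₖ 1/bₖ < 1`** (at equality the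
unit-current potential is a non-constant kernel vector).
[cite: ChenWangLiuBasarJohanssonQiu2016, §4 Corollary 2 («positive semidefinite and of corank 1 iff … r⁺_eff(i,j) < 1/|a_ij|»)] -/
theorem ringLongLine_stabilityMatrix_negDef_iff (hm : 2 ≤ m) (hP : ∀ i j, Kur.P i j = Kur.P j i)
    (hsupp : ∀ i j, Kur.P i j ≠ 0 → j = finRotate (m + 1) i ∨ i = finRotate (m + 1) j)
    (θ : Fin (m + 1) → ℝ)
    (hshort : ∀ k : Fin m, 0 < Kur.P k.castSucc k.succ * Real.cos (θ k.castSucc - θ k.succ)) :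
    (∀ z : Fin (m + 1) → ℝ, (¬ ∃ c : ℝ, z = fun _ => c) → z ⬝ᵥ ((-Kur.toDroopNetwork.lap θ) *ᵥ z) < 0)
      ↔ -(Kur.P (Fin.last m) 0 * Real.cos (θ (Fin.last m) - θ 0))
          * ∑ k : Fin m, 1 / (Kur.P k.castSucc k.succ * Real.cos (θ k.castSucc - θ k.succ)) < 1 := by
  rw [Kur.stabilityMatrix_negDef_iff_linForm_pos]
  simp only [SignedCycle.ring_linForm_eq hm hP hsupp θ]
  have hm0 : 0 < m := by omega
  constructor
  · intro h
    rcases lt_trichotomy (-(Kur.P (Fin.last m) 0 * Real.cos (θ (Fin.last m) - θ 0))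
        * ∑ k : Fin m, 1 / (Kur.P k.castSucc k.succ * Real.cos (θ k.castSucc - θ k.succ))) 1
      with hlt | heq | hgt
    · exact hlt
    · exfalso
      obtain ⟨x, hne, hx⟩ :=
        SignedCycle.exists_nonconst_form_eq_zero_of_mul_resistance_eq_one hshort hm0 heq
      have hnc : ¬ ∃ c : ℝ, x = fun _ => c := by
        rintro ⟨c, hc⟩
        exact hne (by rw [hc])
      exact absurd (h x hnc) (by rw [hx]; exact lt_irrefl 0)
    · exfalso
      obtain ⟨x, hx⟩ := SignedCycle.exists_form_neg_of_one_lt_mul_resistance hshort hgt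
      have hnc : ¬ ∃ c : ℝ, x = fun _ => c := by
        rintro ⟨c, hc⟩
        rw [hc] at hx
        simp at hx
      exact absurd (h x hnc) (not_lt.2 hx.le)
  · intro h x hx
    refine (SignedCycle.form_nonneg_of_mul_resistance_le_one hshort h.le x).lt_of_ne fun h0 => hx ?_
    exact ⟨x 0, funext fun i =>
      SignedCycle.const_of_form_eq_zero_of_mul_resistance_lt_one hshort h h0.symm i⟩

/-- ★★ **Lyapunov reading, necessity: a Lyapunov-stable phase-locked solution with one long line
satisfies `a · Σₖ 1/bₖ ≤ 1`** (lossless, any `ω`, any `Dᵢ > 0`).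
[cite: ChenWangLiuBasarJohanssonQiu2016, §5 and §4 Corollary 2; ManikTimmeWitthaut2017, §2 Lemma 1 (unstable direction)] -/
theorem ringLongLine_criterion_of_lockedSolution_stable (hm : 2 ≤ m) (hD : ∀ i, 0 < Kur.D i)
    (hφ : ∀ i j, Kur.φ i j = 0) (hP : ∀ i j, Kur.P i j = Kur.P j i)
    (hsupp : ∀ i j, Kur.P i j ≠ 0 → j = finRotate (m + 1) i ∨ i = finRotate (m + 1) j)
    {θu : Fin (m + 1) → ℝ} (hθu : ∀ i, Kur.field θu i = (∑ j, Kur.ω j) / ∑ j, Kur.D j)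
    (hshort : ∀ k : Fin m, 0 < Kur.P k.castSucc k.succ * Real.cos (θu k.castSucc - θu k.succ))
    (hst : ∀ ε > 0, ∃ δ > 0, ∀ x₁ : Fin (m + 1) → ℝ, ‖x₁ - θu‖ < δ → ∀ θ : ℝ → Fin (m + 1) → ℝ,
      θ 0 = x₁ → (∀ T : ℝ, ∀ t ∈ Icc 0 T, HasDerivWithinAt θ (Kur.field (θ t)) (Icc 0 T) t) →
      ∀ t, 0 ≤ t → ‖θ t - fun i => θu i + (∑ j, Kur.ω j) / (∑ j, Kur.D j) * t‖ < ε) :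
    -(Kur.P (Fin.last m) 0 * Real.cos (θu (Fin.last m) - θu 0))
        * ∑ k : Fin m, 1 / (Kur.P k.castSucc k.succ * Real.cos (θu k.castSucc - θu k.succ)) ≤ 1 :=
  (Kur.ringLongLine_stabilityMatrix_negSemidef_iff hm hP hsupp θu hshort).1
    (Kur.stabilityMatrix_negSemidef_of_lockedSolution_stable hD hφ hP hθu hst)

/-- ★★ **Lyapunov reading, sufficiency: `a · Σₖ 1/bₖ < 1` makes the phase-locked solution locally
exponentially stable modulo rotation** — a stable operating point WITH a line loaded beyond `π/2`.
[cite: ChenWangLiuBasarJohanssonQiu2016, §5 («there may well exist some critical lines across which the angle differences are greater than π/2») and §4 Corollary 2; ManikTimmeWitthaut2017, §2 Lemma 1] -/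
theorem ringLongLine_lockedSolution_locally_expStable_of_lt_one (hm : 2 ≤ m)
    (hD : ∀ i, 0 < Kur.D i) (hφ : ∀ i j, Kur.φ i j = 0) (hP : ∀ i j, Kur.P i j = Kur.P j i)
    (hsupp : ∀ i j, Kur.P i j ≠ 0 → j = finRotate (m + 1) i ∨ i = finRotate (m + 1) j)
    {θ₀ : Fin (m + 1) → ℝ} (hθ₀ : ∀ i, Kur.field θ₀ i = (∑ j, Kur.ω j) / ∑ j, Kur.D j)
    (hshort : ∀ k : Fin m, 0 < Kur.P k.castSucc k.succ * Real.cos (θ₀ k.castSucc - θ₀ k.succ))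
    (hlt : -(Kur.P (Fin.last m) 0 * Real.cos (θ₀ (Fin.last m) - θ₀ 0))
        * ∑ k : Fin m, 1 / (Kur.P k.castSucc k.succ * Real.cos (θ₀ k.castSucc - θ₀ k.succ)) < 1) :
    ∃ ρ > 0, ∃ C > 0, ∃ lam > 0, ∀ (θ : ℝ → Fin (m + 1) → ℝ) (T : ℝ),
      (∀ t ∈ Icc 0 T, HasDerivWithinAt θ (Kur.field (θ t)) (Icc 0 T) t) → ‖θ 0 - θ₀‖ < ρ →
      ∀ t ∈ Icc 0 T,
        ‖θ t - fun i => θ₀ i + Kur.D ⬝ᵥ (θ 0 - θ₀) / (∑ i, Kur.D i) + (∑ j, Kur.ω j) / (∑ j, Kur.D j) * t‖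
          ≤ C * ‖θ 0 - fun i => θ₀ i + Kur.D ⬝ᵥ (θ 0 - θ₀) / ∑ i, Kur.D i‖ * Real.exp (-lam * t) :=
  Kur.lockedSolution_locally_expStable_of_posCurvature hD hφ hP hθ₀
    (fun u => by
      rw [SignedCycle.ring_linForm_eq hm hP hsupp θ₀ u]
      exact SignedCycle.form_nonneg_of_mul_resistance_le_one hshort hlt.le u)
    (fun u hu => by
      rw [SignedCycle.ring_linForm_eq hm hP hsupp θ₀ u] at hu
      exact ⟨u 0, funext fun i =>
        SignedCycle.const_of_form_eq_zero_of_mul_resistance_lt_one hshort hlt hu i⟩)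

/-- ★★ … hence the phase-locked solution is LYAPUNOV-STABLE. Together with
`ringLongLine_criterion_of_lockedSolution_stable`: `< 1 ⇒` stable `⇒ ≤ 1`.
[cite: ChenWangLiuBasarJohanssonQiu2016, §5, §4 Corollary 2] -/
theorem ringLongLine_lockedSolution_stable_of_lt_one (hm : 2 ≤ m)
    (hD : ∀ i, 0 < Kur.D i) (hφ : ∀ i j, Kur.φ i j = 0) (hP : ∀ i j, Kur.P i j = Kur.P j i)
    (hsupp : ∀ i j, Kur.P i j ≠ 0 → j = finRotate (m + 1) i ∨ i = finRotate (m + 1) j)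
    {θu : Fin (m + 1) → ℝ} (hθu : ∀ i, Kur.field θu i = (∑ j, Kur.ω j) / ∑ j, Kur.D j)
    (hshort : ∀ k : Fin m, 0 < Kur.P k.castSucc k.succ * Real.cos (θu k.castSucc - θu k.succ))
    (hlt : -(Kur.P (Fin.last m) 0 * Real.cos (θu (Fin.last m) - θu 0))
        * ∑ k : Fin m, 1 / (Kur.P k.castSucc k.succ * Real.cos (θu k.castSucc - θu k.succ)) < 1) :
    ∀ ε > 0, ∃ δ > 0, ∀ x₁ : Fin (m + 1) → ℝ, ‖x₁ - θu‖ < δ → ∀ θ : ℝ → Fin (m + 1) → ℝ,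
      θ 0 = x₁ → (∀ T : ℝ, ∀ t ∈ Icc 0 T, HasDerivWithinAt θ (Kur.field (θ t)) (Icc 0 T) t) →
      ∀ t, 0 ≤ t → ‖θ t - fun i => θu i + (∑ j, Kur.ω j) / (∑ j, Kur.D j) * t‖ < ε :=
  Kur.lockedSolution_stable_of_locally_expStable hD
    (Kur.ringLongLine_lockedSolution_locally_expStable_of_lt_one hm hD hφ hP hsupp hθu hshort hlt)

/-- ★★★ **Beyond the threshold the operating point is a TYPE-1 saddle**: if `a · Σₖ 1/bₖ > 1`
then the Jacobian `−D⁻¹L(θ)` (any `Dᵢ > 0`) has exactly ONE characteristic root in the open right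
half-plane, `m − 1` in the open left half-plane and one on the imaginary axis — hyperbolic modulo
rotation of type 1 (hence unstable). [cite: ChenWangLiuBasarJohanssonQiu2016, §5 («by Sylvester's law of inertia … J(θ₀) has exactly the same number of positive, negative, and zero eigenvalues as −L(θ₀)») and §4 Corollary 2; Chiang1995, §6 Theorem 6.7 (R1)] -/
theorem ringLongLine_typeOne_auxJac_of_one_lt (hm : 2 ≤ m) (hD : ∀ i, 0 < Kur.D i)
    (hP : ∀ i j, Kur.P i j = Kur.P j i)
    (hsupp : ∀ i j, Kur.P i j ≠ 0 → j = finRotate (m + 1) i ∨ i = finRotate (m + 1) j)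
    (θ : Fin (m + 1) → ℝ)
    (hshort : ∀ k : Fin m, 0 < Kur.P k.castSucc k.succ * Real.cos (θ k.castSucc - θ k.succ))
    (hgt : 1 < -(Kur.P (Fin.last m) 0 * Real.cos (θ (Fin.last m) - θ 0))
        * ∑ k : Fin m, 1 / (Kur.P k.castSucc k.succ * Real.cos (θ k.castSucc - θ k.succ))) :
    ((Kur.toDroopNetwork.auxJac θ).map (algebraMap ℝ ℂ)).charpoly.roots.countP (fun μ => 0 < μ.re)
        = 1
      ∧ ((Kur.toDroopNetwork.auxJac θ).map (algebraMap ℝ ℂ)).charpoly.roots.countP (fun μ => μ.re < 0)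
        = m - 1
      ∧ ((Kur.toDroopNetwork.auxJac θ).map (algebraMap ℝ ℂ)).charpoly.roots.countP (fun μ => μ.re = 0)
        = 1 := by
  classical
  have hL : (Kur.toDroopNetwork.lap θ).IsHermitian :=
    DroopNetwork.lap_isHermitian (N := Kur.toDroopNetwork) (fun i j => hP i j) θ
  have hrow : ∀ i, ∑ l, Kur.toDroopNetwork.lap θ i l = 0 :=
    fun i => DroopNetwork.sum_lap_row (N := Kur.toDroopNetwork) θ i
  have hform : ∀ x : Fin (m + 1) → ℝ, x ⬝ᵥ Kur.toDroopNetwork.lap θ *ᵥ x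
      = ∑ k : Fin m, (Kur.P k.castSucc k.succ * Real.cos (θ k.castSucc - θ k.succ))
            * (x k.succ - x k.castSucc) ^ 2
        - (-(Kur.P (Fin.last m) 0 * Real.cos (θ (Fin.last m) - θ 0))) * (x 0 - x (Fin.last m)) ^ 2 := by
    intro x
    rw [Kur.dotProduct_lap_mulVec]
    simp only [toDroopNetwork_linWeight]
    exact SignedCycle.ring_linForm_eq hm hP hsupp θ x
  obtain ⟨h1, h2, h3⟩ := SignedCycle.inertia_of_one_lt_mul_resistance hL hshort hform hgt
  set i₀ : Fin (m + 1) := 0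
  have hHm := refMinor_isHermitian hL i₀
  obtain ⟨r1, r2, -, hreg⟩ := RefNode.refMinor_counts hL hrow h2 i₀ hHm
  obtain ⟨t1, t2, t3⟩ := Kur.countP_roots_charpoly_toDroopNetwork_auxJac hP hD θ i₀ hHm hreg
  refine ⟨?_, ?_, t3⟩
  · rw [t1, r2, h1]
  · rw [t2, r1, h3]

end NonuniformKuramoto

/-! ### §4. The classical swing ring with one long line -/

namespace ClassicalModel

namespace LosslessSystem

variable {m : ℕ} (S : LosslessSystem (m + 1) 0)

/-- ★★ **Swing model, necessity: a Lyapunov-stable synchronous solution of the swing ring with one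
long line satisfies `a · Σₖ 1/bₖ ≤ 1`** (`Mᵢ, Dᵢ > 0`, any injections).
[cite: ChenWangLiuBasarJohanssonQiu2016, §4 Corollary 2; ManikTimmeWitthaut2017, §3 Lemma 1 («for both the Kuramoto system and the power grid model»)] -/
theorem ringLongLine_criterion_of_stable_syncSolution (hm : 2 ≤ m) (hC : ∀ i j, S.C i j = S.C j i)
    (hsupp : ∀ i j, S.C i j ≠ 0 → j = finRotate (m + 1) i ∨ i = finRotate (m + 1) j)
    (hM : ∀ i, 0 < S.M i) (hD : ∀ i, 0 < S.D i) {θe : Fin (m + 1) → ℝ}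
    (he : ∀ i, S.P i - S.D i * ((∑ j, S.P j) / ∑ j, S.D j) = S.flow θe i)
    (hshort : ∀ k : Fin m, 0 < S.C k.castSucc k.succ * Real.cos (θe k.castSucc - θe k.succ))
    (hst : ∀ ε > 0, ∃ δ > 0, ∀ x₁ : (Fin (m + 1) → ℝ) × (Fin (m + 1) → ℝ),
      dist x₁ (θe, fun _ => (∑ j, S.P j) / ∑ j, S.D j) < δ →
      ∀ X : ℝ → (Fin (m + 1) → ℝ) × (Fin (m + 1) → ℝ), X 0 = x₁ →
        (∀ T : ℝ, ∀ t ∈ Icc 0 T, HasDerivWithinAt X (S.field (X t)) (Icc 0 T) t) →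
        ∀ t, 0 ≤ t → dist (X t)
          ((fun j => θe j + (∑ j, S.P j) / (∑ j, S.D j) * t), fun _ => (∑ j, S.P j) / ∑ j, S.D j)
            < ε) :
    -(S.C (Fin.last m) 0 * Real.cos (θe (Fin.last m) - θe 0))
        * ∑ k : Fin m, 1 / (S.C k.castSucc k.succ * Real.cos (θe k.castSucc - θe k.succ)) ≤ 1 := by
  by_contra hgt
  obtain ⟨x, hx⟩ := SignedCycle.exists_form_neg_of_one_lt_mul_resistance hshort (not_le.1 hgt)
  have h := S.hessForm_nonneg_of_stable_syncSolution hC hM hD he hst x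
  have e : 1 / 2 * ∑ i, ∑ j, S.C i j * Real.cos (θe i - θe j) * (x i - x j) ^ 2
      = ∑ i, x i * ∑ j, S.C i j * Real.cos (θe i - θe j) * (x i - x j) := by
    rw [SignedCycle.ring_linForm_eq hm hC hsupp θe x,
      SignedCycle.sum_sum_eq_two_mul_sum_edges hm (W := fun i j => S.C i j * Real.cos (θe i - θe j))
        (fun i j => by show S.C i j * Real.cos (θe i - θe j) = S.C j i * Real.cos (θe j - θe i)
                       rw [hC i j, ← Real.cos_neg, neg_sub])
        (fun i j hne => hsupp i j (left_ne_zero_of_mul hne)) (fun i j => (x i - x j) ^ 2)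
        (fun i j => by ring)]
    have e1 : ∀ k : Fin m, (x k.castSucc - x k.succ) ^ 2 = (x k.succ - x k.castSucc) ^ 2 :=
      fun k => by ring
    have e0 : (x (Fin.last m) - x 0) ^ 2 = (x 0 - x (Fin.last m)) ^ 2 := by ring
    simp only [e1, e0]
    ring
  rw [e, SignedCycle.ring_linForm_eq hm hC hsupp θe x] at h
  exact absurd hx (not_lt.2 h)

/-- ★★ **Swing model, sufficiency: `a · Σₖ 1/bₖ < 1` makes the synchronous solution Lyapunov-stable
(and attracting in the co-rotating frame)** — via `stable_syncSolution_of_hessForm_posDef`.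
[cite: ChenWangLiuBasarJohanssonQiu2016, §4 Corollary 2; ManikTimmeWitthaut2017, §3 Lemma 1 and Cor. 1] -/
theorem ringLongLine_stable_syncSolution_of_lt_one (hm : 2 ≤ m) (hC : ∀ i j, S.C i j = S.C j i)
    (hsupp : ∀ i j, S.C i j ≠ 0 → j = finRotate (m + 1) i ∨ i = finRotate (m + 1) j)
    (hM : ∀ i, 0 < S.M i) (hD : ∀ i, 0 < S.D i) {θe : Fin (m + 1) → ℝ}
    (he : ∀ i, S.P i - S.D i * ((∑ j, S.P j) / ∑ j, S.D j) = S.flow θe i)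
    (hshort : ∀ k : Fin m, 0 < S.C k.castSucc k.succ * Real.cos (θe k.castSucc - θe k.succ))
    (hlt : -(S.C (Fin.last m) 0 * Real.cos (θe (Fin.last m) - θe 0))
        * ∑ k : Fin m, 1 / (S.C k.castSucc k.succ * Real.cos (θe k.castSucc - θe k.succ)) < 1)
    {ε : ℝ} (hε : 0 < ε) :
    ∃ δ > 0, ∀ x₁ : (Fin (m + 1) → ℝ) × (Fin (m + 1) → ℝ),
      dist x₁ (θe, fun _ => (∑ j, S.P j) / ∑ j, S.D j) < δ →
      (∃ X : ℝ → (Fin (m + 1) → ℝ) × (Fin (m + 1) → ℝ), X 0 = x₁ ∧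
          ∀ T : ℝ, ∀ t ∈ Icc 0 T, HasDerivWithinAt X (S.field (X t)) (Icc 0 T) t) ∧
        ∀ X : ℝ → (Fin (m + 1) → ℝ) × (Fin (m + 1) → ℝ), X 0 = x₁ →
          (∀ T : ℝ, ∀ t ∈ Icc 0 T, HasDerivWithinAt X (S.field (X t)) (Icc 0 T) t) →
          ∀ t, 0 ≤ t → dist ((fun j => (X t).1 j - (∑ j, S.P j) / (∑ j, S.D j) * t),
              (fun j => (X t).2 j - (∑ j, S.P j) / ∑ j, S.D j)) (θe, 0) < ε := by
  have hpos : ∀ v : Fin (m + 1) → ℝ, (∃ i j, v i ≠ v j) →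
      0 < 1 / 2 * ∑ i, ∑ j, S.C i j * Real.cos (θe i - θe j) * (v i - v j) ^ 2 := by
    intro v hv
    have e : 1 / 2 * ∑ i, ∑ j, S.C i j * Real.cos (θe i - θe j) * (v i - v j) ^ 2
        = ∑ i, v i * ∑ j, S.C i j * Real.cos (θe i - θe j) * (v i - v j) := by
      rw [SignedCycle.ring_linForm_eq hm hC hsupp θe v,
        SignedCycle.sum_sum_eq_two_mul_sum_edges hm (W := fun i j => S.C i j * Real.cos (θe i - θe j))
          (fun i j => by show S.C i j * Real.cos (θe i - θe j) = S.C j i * Real.cos (θe j - θe i)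
                         rw [hC i j, ← Real.cos_neg, neg_sub])
          (fun i j hne => hsupp i j (left_ne_zero_of_mul hne)) (fun i j => (v i - v j) ^ 2)
          (fun i j => by ring)]
      have e1 : ∀ k : Fin m, (v k.castSucc - v k.succ) ^ 2 = (v k.succ - v k.castSucc) ^ 2 :=
        fun k => by ring
      have e0 : (v (Fin.last m) - v 0) ^ 2 = (v 0 - v (Fin.last m)) ^ 2 := by ring
      simp only [e1, e0]
      ring
    rw [e, SignedCycle.ring_linForm_eq hm hC hsupp θe v]
    refine (SignedCycle.form_nonneg_of_mul_resistance_le_one hshort hlt.le v).lt_of_ne fun h0 => ?_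
    obtain ⟨i, j, hij⟩ := hv
    have hc := SignedCycle.const_of_form_eq_zero_of_mul_resistance_lt_one hshort hlt h0.symm
    exact hij (by rw [hc i, hc j])
  obtain ⟨δ, hδ, h⟩ := S.stable_syncSolution_of_hessForm_posDef hC hM hD he hpos hε
  exact ⟨δ, hδ, fun x₁ hx₁ => ⟨(h x₁ hx₁).1, fun X hX0 hX t ht => ((h x₁ hx₁).2 X hX0 hX).1 t ht⟩⟩

/-- ★★★ **Swing model, beyond the threshold: a TYPE-1 saddle** — the swing Jacobian at `(θ, 0)`
has exactly ONE root in the open right half-plane, `(m − 1) + (m + 1)` in the open left half-plane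
and one on the axis. [cite: ChenWangLiuBasarJohanssonQiu2016, §4 Corollary 2; Chiang1995, §6.3 Theorem 6.1] -/
theorem ringLongLine_typeOne_phaseJac_of_one_lt (hm : 2 ≤ m) (hC : ∀ i j, S.C i j = S.C j i)
    (hsupp : ∀ i j, S.C i j ≠ 0 → j = finRotate (m + 1) i ∨ i = finRotate (m + 1) j)
    (hM : ∀ i, 0 < S.M i) (hD : ∀ i, 0 < S.D i) (θ : Fin (m + 1) → ℝ)
    (hshort : ∀ k : Fin m, 0 < S.C k.castSucc k.succ * Real.cos (θ k.castSucc - θ k.succ))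
    (hgt : 1 < -(S.C (Fin.last m) 0 * Real.cos (θ (Fin.last m) - θ 0))
        * ∑ k : Fin m, 1 / (S.C k.castSucc k.succ * Real.cos (θ k.castSucc - θ k.succ))) :
    ((S.phaseJac θ).map (algebraMap ℝ ℂ)).charpoly.roots.countP (fun μ => 0 < μ.re) = 1
      ∧ ((S.phaseJac θ).map (algebraMap ℝ ℂ)).charpoly.roots.countP (fun μ => μ.re < 0)
        = m - 1 + (m + 1)
      ∧ ((S.phaseJac θ).map (algebraMap ℝ ℂ)).charpoly.roots.countP (fun μ => μ.re = 0) = 1 := by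
  classical
  have hH : (S.hessMatrix θ).IsHermitian := S.hessMatrix_isHermitian hC θ
  have hrow : ∀ i, ∑ l, S.hessMatrix θ i l = 0 := fun i => sum_hessMatrix_row S θ i
  have hform : ∀ x : Fin (m + 1) → ℝ, x ⬝ᵥ S.hessMatrix θ *ᵥ x
      = ∑ k : Fin m, (S.C k.castSucc k.succ * Real.cos (θ k.castSucc - θ k.succ))
            * (x k.succ - x k.castSucc) ^ 2
        - (-(S.C (Fin.last m) 0 * Real.cos (θ (Fin.last m) - θ 0))) * (x 0 - x (Fin.last m)) ^ 2 := by
    intro x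
    rw [S.hessMatrix_form]
    exact SignedCycle.ring_linForm_eq hm hC hsupp θ x
  obtain ⟨h1, h2, h3⟩ := SignedCycle.inertia_of_one_lt_mul_resistance hH hshort hform hgt
  set i₀ : Fin (m + 1) := 0
  have hHm := refMinor_isHermitian hH i₀
  obtain ⟨r1, r2, -, hreg⟩ := RefNode.refMinor_counts hH hrow h2 i₀ hHm
  obtain ⟨t1, t2, t3⟩ := S.countP_roots_charpoly_phaseJac_modRotation hM hD hC θ i₀ hHm hreg
  refine ⟨?_, ?_, t3⟩
  · rw [t1, r2, h1]
  · rw [t2, r1, h3]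

end LosslessSystem

end ClassicalModel

end Literature.MathematicalPhysics.PowerSystems

end
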